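import Mathlib
import Summits.ValiantsHypothesis.ValiantsHypothesis.Theses.ValuativeGCT
import Summits.ValiantsHypothesis.ValiantsHypothesis.Theorems.ValuativeGCTTailFlipStubIsobaricInheritance

/-!
# Crux `ValuativeGCT.TailFlip` (stmt-ValiantsHypothesis-15687) — idea card `full-rank-affine-anchors`
# (crux-ideate round 2, ideator 5): First lemma and Transfer, STATEMENTS ONLY (no skeleton).

Letters: inner size `n`, padding `j`, `m = n + j`, outer degree `δ`, inner top variable
`x_t = X (topMatIdx n)` (= `x_{nn}`; under `paddedForm` it becomes the padding variable),
inner shape `μ ⊢ nδ`, lifted shape `μ♯m = rowLift μ j`.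

* `BiIsobaricInheritance` — the First lemma: the landed isobaric engine
  (`Theorems.TailFlip.stub_isobaricInheritance`, hypothesis "every monomial of `A_l · per_n` has the
  SAME `x_t`-exponent `e₀ l`") with the hypothesis weakened to "the `x_t`-exponents of `A_l · per_n`
  lie in `{e₀ l, e₀ l + 1}`".  On such points the Kadish–Landsberg twist
  `coeff_e ↦ ((e_t + j)!/e_t!) coeff_e` equals `c_l · ρ_l^{e_t}` with `c_l = (e₀ l + j)^{(j)} ρ_l^{-e₀ l}`,
  `ρ_l = (e₀ l + 1 + j)/(e₀ l + 1)`, i.e. the twisted coefficient vector is `c_l` times the coefficient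
  vector of the TORUS translate `h(…, ρ_l x_t)`; a weight vector `F_i` of weight `μ*` takes the value
  `ρ_l^{κ} F_i(h)` there (`κ` = the `x_t`-component of the weight, the same for all `i`), so the
  twisted evaluation matrix is the untwisted one with rescaled columns and
  `Theorems.ValuativeFlip.stub_twistedInheritance` (landed) applies.
* `TopRowConfined A` / `AffineSupport` — the point class: if the top ROW of `A` is supported on the
  variables of one row of the matrix of variables (`linSubst A : X i ↦ ∑ j, A j i • X j` feeds `x_t`
  only into that row), then `A · per_n` is affine-linear in `x_t` (each permutation monomial meets a
  row once), hence bi-isobaric with `e₀ = 0`.  `A = 1`, permutation matrices, and a codimension-`(n²-n)`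
  family of INVERTIBLE `A` qualify: the certified points are translates of `per_n` of full border
  complexity, never `End · det`-points unless `X₀₀^j per_n ∈ Δ(det_{n+j})` itself.
* `AffTail` — the Transfer `C⁺` (stronger than the crux): at every tail position an affine-anchored
  certificate of size `D` at inner size `n` and a centre `(U, r)` at size `n + j` with
  `dim T_U(μ♯(n+j)) < D`.  `AffTail_implies : Prop` records the composition to be proved in crux-plan
  (`BiIsobaricInheritance → AffTail → TailFlip`, bookkeeping as in `Lines/Sketch.lean`'s `TailFlip_of`).
-/

set_option linter.dupNamespace false

namespace Summit.ValiantsHypothesis.ValiantsHypothesis.Cruxes.TailFlip.FullRankAffineAnchors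

open MvPolynomial
open scoped BigOperators Matrix
open Literature.NumberTheory.DiophantineGeometry
open Literature.Computability.AlgebraicComplexity
open Literature.Computability.Complexity
open Summit.ValiantsHypothesis.ValiantsHypothesis.Theses.ValuativeGCT

noncomputable section

/-- The valuative truncation count of the crux, verbatim: `dim T_U(λ)` at size `m`, degree `δ`,
centre `(U, r)`, weight `λ* = partitionWeightLex m λ` (= `(dualOfPartition (m*m) λ).toMatIdx`). -/
def truncFinrank (m : ℕ) [NeZero m] (U : Submodule ℂ (MatIdx m → ℂ)) (r δ : ℕ)
    (lam : Nat.Partition (m * δ)) : ℕ :=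
  let χ : Weight (MatIdx m) := (Weight.dualOfPartition (m * m) lam).toMatIdx
  let T : Submodule ℂ (MvPolynomial (MatIdx m × MatIdx m) ℂ) :=
    MvPolynomial.homogeneousSubmodule (MatIdx m × MatIdx m) ℂ (m * δ) ⊓
      ((MvPolynomial.vanishingIdeal ℂ {p : MatIdx m × MatIdx m → ℂ | ∀ j : MatIdx m, (fun i => p (j, i)) ∈ U}) ^ (δ * (m - r))).restrictScalars ℂ ⊓
      (⨅ (M : Matrix (MatIdx m) (MatIdx m) ℂ) (_ : linSubst (MatIdx m) ℂ M (detFormLex ℂ m) = detFormLex ℂ m),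
        LinearMap.ker ((MvPolynomial.aeval (R := ℂ) fun p : MatIdx m × MatIdx m =>
          ∑ l : MatIdx m, M l p.2 • MvPolynomial.X (p.1, l)).toLinearMap -
          LinearMap.id (R := ℂ) (M := MvPolynomial (MatIdx m × MatIdx m) ℂ))) ⊓
      (⨅ (g : Matrix.GeneralLinearGroup (MatIdx m) ℂ) (_ : IsUpperTriangular g),
        LinearMap.ker ((MvPolynomial.aeval (R := ℂ) fun p : MatIdx m × MatIdx m =>
          ∑ l : MatIdx m, ((g⁻¹ : Matrix.GeneralLinearGroup (MatIdx m) ℂ) : Matrix (MatIdx m) (MatIdx m) ℂ) p.1 l •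
            MvPolynomial.X (l, p.2)).toLinearMap -
          weightChar χ g • LinearMap.id (R := ℂ) (M := MvPolynomial (MatIdx m × MatIdx m) ℂ)))
  Module.finrank ℂ ↥T

/-- **First lemma (engine, provable now over the landed `stub_twistedInheritance`).**
BI-ISOBARIC untwisted inheritance: if every monomial of each inner point `A_l · per_n` has
`x_t`-exponent in `{e₀ l, e₀ l + 1}`, an UNTWISTED nonsingular evaluation matrix of inner
highest-weight vectors of weight `μ*` certifies `D ≤ mult_{(μ♯(n+j))*} ℂ[Δ_{n+j}(X₀₀^j per_n)]`
for EVERY padding `j`. (`e (topMatIdx n) = e₀ l` for all `e` is the landed isobaric case.) -/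
def BiIsobaricInheritance : Prop :=
  ∀ (n j δ : ℕ) [NeZero n] [NeZero (n + j)] (μ : Nat.Partition (n * δ)), μ.parts.card ≤ n * n →
    ∀ (D : ℕ) (F : Fin D → MvPolynomial (DegIdx (MatIdx n) n) ℂ),
      (∀ i, F i ∈ highestWeightSpace (coordRep (MatIdx n) ℂ n) (partitionWeightLex n μ)) →
      ∀ (A : Fin D → Matrix (MatIdx n) (MatIdx n) ℂ) (e₀ : Fin D → ℕ),
        (∀ l, ∀ e ∈ (linSubst (MatIdx n) ℂ (A l) (paddedPerFormLex ℂ n n)).support,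
            e (topMatIdx n) = e₀ l ∨ e (topMatIdx n) = e₀ l + 1) →
        (Matrix.of fun i l : Fin D => MvPolynomial.aeval
            (fun e : DegIdx (MatIdx n) n =>
              MvPolynomial.coeff e.1 (linSubst (MatIdx n) ℂ (A l) (paddedPerFormLex ℂ n n))) (F i)).det ≠ 0 →
        D ≤ orbitMultiplicity ℂ (paddedPerFormLex ℂ n (n + j)) (n + j)
          (partitionWeightLex (n + j) (rowLift μ j))

/-- The scalar form of the bi-isobaric twist (the content of the First lemma's proof): on a form
`h` whose `x_t`-exponents lie in `{e₀, e₀+1}` the twisted evaluation of a weight vector of weight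
`μ*` is a NONZERO scalar multiple (depending on `e₀, j, δ, μ` only) of the untwisted one. -/
def BiIsobaricTwistScalar : Prop :=
  ∀ (n j δ e₀ : ℕ) [NeZero n] (μ : Nat.Partition (n * δ)), μ.parts.card ≤ n * n →
    ∃ c : ℂ, c ≠ 0 ∧ ∀ (F : MvPolynomial (DegIdx (MatIdx n) n) ℂ),
      F ∈ highestWeightSpace (coordRep (MatIdx n) ℂ n) (partitionWeightLex n μ) →
      ∀ (h : MvPolynomial (MatIdx n) ℂ),
        (∀ e ∈ h.support, e (topMatIdx n) = e₀ ∨ e (topMatIdx n) = e₀ + 1) →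
        MvPolynomial.aeval (fun e : DegIdx (MatIdx n) n =>
            (((e.1 (topMatIdx n) + j).descFactorial j : ℕ) : ℂ) * MvPolynomial.coeff e.1 h) F =
          c * MvPolynomial.aeval (fun e : DegIdx (MatIdx n) n => MvPolynomial.coeff e.1 h) F

/-- The point class: the top row of `A` (the coefficients with which `x_t` enters the substituted
variables, `X i ↦ ∑ j, A j i • X j`) is supported on the variables of ONE row of the `n × n` matrix
of variables. -/
def TopRowConfined {n : ℕ} [NeZero n] (A : Matrix (MatIdx n) (MatIdx n) ℂ) : Prop :=
  ∃ r : Fin n, ∀ i : MatIdx n, A (topMatIdx n) i ≠ 0 → (ofLex i).1 = r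

/-- **Scope lemma, first half (elementary):** a top-row-confined substitution keeps `per_n`
affine-linear in `x_t` (every permutation monomial uses exactly one variable of each row), so
`A · per_n` is bi-isobaric with `e₀ = 0`; in particular `A = 1` and every permutation matrix, and a
codimension-`(n² - n)` family of invertible `A`. -/
def AffineSupport : Prop :=
  ∀ (n : ℕ) [NeZero n] (A : Matrix (MatIdx n) (MatIdx n) ℂ), TopRowConfined A →
    ∀ e ∈ (linSubst (MatIdx n) ℂ A (paddedPerFormLex ℂ n n)).support, e (topMatIdx n) ≤ 1

/-- **Scope lemma, second half (elementary weight bookkeeping):** on `x_t`-affine points only FLAT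
inner shapes can be certified — if `μ₁ > δ` every weight-`μ*` highest-weight vector vanishes at every
inner form that is affine-linear in `x_t` (each of its `δ` coefficient factors would need `x_t`-exponent
`≤ 1`, but they total `μ₁`).  So affine anchors serve exactly `μ ⊆ (δ^{n²})`, `ℓ(μ) ≥ n`, lifted to the
KL-extremal shapes `(δ(m-n) + μ₁, μ̄)` with `δ(m-n) ≤ λ₁ ≤ δ(m-n+1)`, body `≥ (n-1)δ`. -/
def FlatScope : Prop :=
  ∀ (n δ : ℕ) [NeZero n] (μ : Nat.Partition (n * δ)), μ.parts.card ≤ n * n → δ < μ.parts.sup →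
    ∀ (F : MvPolynomial (DegIdx (MatIdx n) n) ℂ),
      F ∈ highestWeightSpace (coordRep (MatIdx n) ℂ n) (partitionWeightLex n μ) →
      ∀ (h : MvPolynomial (MatIdx n) ℂ), (∀ e ∈ h.support, e (topMatIdx n) ≤ 1) →
        MvPolynomial.aeval (fun e : DegIdx (MatIdx n) n => MvPolynomial.coeff e.1 h) F = 0

/-- **Transfer `C⁺` (AFFINE-ANCHORED TAIL; implies the crux through `BiIsobaricInheritance` and
`AffineSupport`, and is crux-strength like every complete line):** for every slope `a/b > 1` and
every `c`, eventually in the inner size `n`, at every tail position `m = n + j` there are a degree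
`δ`, a FLAT inner shape `μ ⊢ nδ`, an untwisted nonsingular evaluation matrix of `D` inner
highest-weight vectors of weight `μ*` at TOP-ROW-CONFINED INVERTIBLE translates of `per_n`, and an
admissible centre `(U, r)` at size `m`, with `dim T_U(μ♯m) < D`.  The per half is `m`-free and lives
on points of full border complexity; the `∀ m` bears on the det census alone. -/
def AffTail : Prop :=
  ∀ a b : ℕ, b < a → ∀ c : ℕ, ∃ n₀ : ℕ, ∀ n ≥ n₀, ∀ (j : ℕ), ∀ [NeZero n], ∀ [NeZero (n + j)],
    a * n < b * (n + j) → n + j ≤ 2 ^ ((Nat.log 2 n + c) ^ c) →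
      ∃ (δ : ℕ) (μ : Nat.Partition (n * δ)) (D : ℕ)
        (F : Fin D → MvPolynomial (DegIdx (MatIdx n) n) ℂ)
        (A : Fin D → Matrix (MatIdx n) (MatIdx n) ℂ)
        (U : Submodule ℂ (MatIdx (n + j) → ℂ)) (r : ℕ),
        μ.parts.card ≤ n * n ∧ μ.parts.sup ≤ δ ∧
        (∀ i, F i ∈ highestWeightSpace (coordRep (MatIdx n) ℂ n) (partitionWeightLex n μ)) ∧
        (∀ l, TopRowConfined (A l) ∧ IsUnit (A l).det) ∧
        (Matrix.of fun i l : Fin D => MvPolynomial.aeval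
            (fun e : DegIdx (MatIdx n) n =>
              MvPolynomial.coeff e.1 (linSubst (MatIdx n) ℂ (A l) (paddedPerFormLex ℂ n n))) (F i)).det ≠ 0 ∧
        (∀ u ∈ U, (Matrix.of fun a' b' : Fin (n + j) => u (toLex (a', b'))).rank ≤ r) ∧
        truncFinrank (n + j) U r δ (rowLift μ j) < D

/-- The composition to be kernel-checked at crux-plan time (bookkeeping only: `partitionWeightLex`
is the crux's `(dualOfPartition _ λ).toMatIdx`, `ℓ(rowLift μ j) = ℓ(μ) ≤ n² ≤ (n+j)²`, `m = n + j`
from `a n < b m`, `b < a`; pattern of `TailFlip_of` in `Lines/Sketch.lean`). -/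
def AffTail_implies : Prop :=
  BiIsobaricInheritance → AffineSupport → AffTail → TailFlip


/-! ## Idea card `facet-seminvariant-completion` (ideator 5, card 2): statements only

Letters: inner size `n`, padding `j`, `m = n + j`, degree `δ`, inner shape `ν ⊢ nδ` (`≤ n²` parts),
FACET shape `π ⊢ mδ` with parts `(jδ) ::ₘ ν.parts` (first row EXACTLY `δ(m-n)`, the Kadish–Landsberg
minimum; `ℓ(π) = ℓ(ν) + 1`; body `|ν| = nδ`).  `ι : MatIdx n → MatIdx m` is the order embedding onto
the `n²` indices immediately BELOW `topMatIdx m` (so that `partitionWeightLex m π` puts `jδ` on the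
fresh padding variable `X_top` and `ν` on the image of `ι` exactly as `partitionWeightLex n ν` puts it
on `MatIdx n`).  Pure padded points: `X_top^j · rename ι h`, `h` an inner form NOT involving `X_top`. -/

/-- The embedding just below the top index. -/
def IsSubTopEmbedding {n j : ℕ} [NeZero n] [NeZero (n + j)] (ι : MatIdx n → MatIdx (n + j)) : Prop :=
  StrictMono ι ∧ (∀ i, ι i < topMatIdx (n + j)) ∧
    (∀ k : MatIdx (n + j), k < topMatIdx (n + j) → (∃ i, ι i ≤ k) → k ∈ Set.range ι)

/-- **First lemma of card 2 (FACET COMPLETION; a plethysm statement, no permanent in it).**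
If the facet weight `π = (jδ; ν)` occurs in `ℂ[Sym^m ℂ^{m²}]` at all, then EVERY inner
highest-weight vector `F₀` of weight `ν*` (size `n`) is the pure-padded restriction of an outer
highest-weight vector `F` of weight `π*` (size `m = n + j`): `F(X_top^j · ι h) = F₀(h)` for every
inner form `h`.  (Numerically verified — `toy/ressurj*.py`, ~150 cases, `(s, n, j, δ)` up to
`(3, 5, 6, 6)`: the restriction map has rank `a_ν(δ[n])` whenever `a_π(δ[m]) > 0`, and `a_π > 0` in
every tested case with `jδ ≥ ν₁ + 3`; conjectural in general; candidate proof: the extremal projector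
of `𝔤𝔩_{m²}` relative to the parabolic fixing `X_top`, i.e. an explicit Capelli/exchange formula
`F = Σ_k c_k Ω^k F₀`.) -/
def FacetCompletion : Prop :=
  ∀ (n j δ : ℕ) [NeZero n] [NeZero (n + j)] (ν : Nat.Partition (n * δ)), ν.parts.card ≤ n * n →
    ∀ (π : Nat.Partition ((n + j) * δ)), π.parts = (j * δ) ::ₘ ν.parts →
    ∀ (ι : MatIdx n → MatIdx (n + j)), IsSubTopEmbedding ι →
      0 < plethysmCoeff ℂ (MatIdx (n + j)) (n + j) (partitionWeightLex (n + j) π) →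
      ∀ F₀ : MvPolynomial (DegIdx (MatIdx n) n) ℂ,
        F₀ ∈ highestWeightSpace (coordRep (MatIdx n) ℂ n) (partitionWeightLex n ν) →
        ∃ F : MvPolynomial (DegIdx (MatIdx (n + j)) (n + j)) ℂ,
          F ∈ highestWeightSpace (coordRep (MatIdx (n + j)) ℂ (n + j)) (partitionWeightLex (n + j) π) ∧
          ∀ h : MvPolynomial (MatIdx n) ℂ, h.IsHomogeneous n →
            MvPolynomial.aeval (formCoeff (n + j) (X (topMatIdx (n + j)) ^ j * rename ι h)) F =
              MvPolynomial.aeval (formCoeff n h) F₀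

/-- **FACET INHERITANCE (corollary of `FacetCompletion` + the landed evaluation-certificate engine
`stub_evalRankLowerBound`): the "≥" half of BLMW Problem 6.10 for `per_n` on the minimal-first-row
facet, UNTWISTED, through GENUINE `GL_{m²}`-translates of the padded permanent.**  An untwisted
nonsingular evaluation matrix of inner highest-weight vectors of weight `ν*` at ARBITRARY inner
points `A_l · per_n` (e.g. invertible `A_l`) certifies `D ≤ mult_{π*} ℂ[Δ_m(X₀₀^{m-n} per_n)]` for
the facet shape `π = (δ(m-n); ν)` whenever `π` occurs in the ambient plethysm; with `D = P_n(ν)`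
(generic translates): `P_n(ν) ≤ mult_{π*}`.  The padded points `X_top^j · ι(A_l · per_n)` are
`g_l · pp`, `g_l ∈ GL_{m²}` when `A_l` is invertible, hence lie in `Δ(det_m)` iff `pp` does
(certificate domination is EXACTLY neutral). -/
def FacetInheritance : Prop :=
  ∀ (n j δ : ℕ) [NeZero n] [NeZero (n + j)] (ν : Nat.Partition (n * δ)), ν.parts.card ≤ n * n →
    ∀ (π : Nat.Partition ((n + j) * δ)), π.parts = (j * δ) ::ₘ ν.parts →
      0 < plethysmCoeff ℂ (MatIdx (n + j)) (n + j) (partitionWeightLex (n + j) π) →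
      ∀ (D : ℕ) (F : Fin D → MvPolynomial (DegIdx (MatIdx n) n) ℂ),
        (∀ i, F i ∈ highestWeightSpace (coordRep (MatIdx n) ℂ n) (partitionWeightLex n ν)) →
        ∀ (A : Fin D → Matrix (MatIdx n) (MatIdx n) ℂ),
          (Matrix.of fun i l : Fin D => MvPolynomial.aeval
              (fun e : DegIdx (MatIdx n) n =>
                MvPolynomial.coeff e.1 (linSubst (MatIdx n) ℂ (A l) (paddedPerFormLex ℂ n n))) (F i)).det ≠ 0 →
          D ≤ orbitMultiplicity ℂ (paddedPerFormLex ℂ n (n + j)) (n + j) (partitionWeightLex (n + j) π)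

/-- **Transfer `C⁺` of card 2 (FACET TAIL = the inner catch-up race):** at every tail position
`m = n + j` some inner datum `(δ, ν)` whose facet shape occurs, an UNTWISTED inner certificate of
size `D` at arbitrary (e.g. invertible) inner points, and an admissible centre `(U, r)` at size `m`
with `dim T_U(π) < D`.  `FacetInheritance → FacetTail → TailFlip` is bookkeeping; with
`D = P_n(ν)` the per side of the whole tail is the coordinate ring of `Δ(per_n)` itself. -/
def FacetTail : Prop :=
  ∀ a b : ℕ, b < a → ∀ c : ℕ, ∃ n₀ : ℕ, ∀ n ≥ n₀, ∀ (j : ℕ), ∀ [NeZero n], ∀ [NeZero (n + j)],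
    a * n < b * (n + j) → n + j ≤ 2 ^ ((Nat.log 2 n + c) ^ c) →
      ∃ (δ : ℕ) (ν : Nat.Partition (n * δ)) (π : Nat.Partition ((n + j) * δ)) (D : ℕ)
        (F : Fin D → MvPolynomial (DegIdx (MatIdx n) n) ℂ)
        (A : Fin D → Matrix (MatIdx n) (MatIdx n) ℂ)
        (U : Submodule ℂ (MatIdx (n + j) → ℂ)) (r : ℕ),
        ν.parts.card ≤ n * n ∧ π.parts = (j * δ) ::ₘ ν.parts ∧
        0 < plethysmCoeff ℂ (MatIdx (n + j)) (n + j) (partitionWeightLex (n + j) π) ∧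
        (∀ i, F i ∈ highestWeightSpace (coordRep (MatIdx n) ℂ n) (partitionWeightLex n ν)) ∧
        (Matrix.of fun i l : Fin D => MvPolynomial.aeval
            (fun e : DegIdx (MatIdx n) n =>
              MvPolynomial.coeff e.1 (linSubst (MatIdx n) ℂ (A l) (paddedPerFormLex ℂ n n))) (F i)).det ≠ 0 ∧
        (∀ u ∈ U, (Matrix.of fun a' b' : Fin (n + j) => u (toLex (a', b'))).rank ≤ r) ∧
        truncFinrank (n + j) U r δ π < D

/-- The composition for crux-plan (card 2): pure bookkeeping over `FacetInheritance`
(`ℓ(π) = ℓ(ν) + 1 ≤ n² + 1 ≤ (n+j)²`, `m = n + j`, the crux's `χ` is `partitionWeightLex`). -/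
def FacetTail_implies : Prop :=
  FacetInheritance → FacetTail → TailFlip

example : True := trivial

end

end Summit.ValiantsHypothesis.ValiantsHypothesis.Cruxes.TailFlip.FullRankAffineAnchors
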